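import Summits.CriticalPhenomena.SAWScalingLimit.Theorems.SAWLeftRightFKGFKGToTraversalBoundNecklaceSpine
import HarnessLib

/-!
# Necklace assembly (far-tip form), part 7: the attached spine of a chord (both blobs)

Crux `SAWLeftRightFKG.FKGToTraversalBound` (stmt-CriticalPhenomena-1878), line `slit-necklace`
(reshape r4), stub `stub_necklaceAssemblyFar`, step A2 of the chart
`Cruxes/FKGToTraversalBound/Lines/slit-necklace-chart-r4.md` §3.

Given a tame presentation `(C, S')` of `D_δ` whose defect set is CLOSED and ATTACHED (the normal form of
`tamePresentation_attached`, p135403) and two non-isolated vertices `a₀, b₀` of `D_δ` (the endpoints of the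
chord), there are BLOBS `Ka ∋ a₀`, `Kb ∋ b₀` of sites within `infDist (δ·e) Dᶜ + 3δ` of the respective mesh
points `δ·a₀`, `δ·b₀`, such that the whole spine `Ka ∪ Kb ∪ S'` is attached: every spine site is joined to the
trace of `C` by a lattice walk through spine and trace sites — exactly the spine hypotheses of `SlotLaw`,
`NecklaceWitnessFar` and `NecklaceBookkeeping`.

One blob (`necklace_blob`): an endpoint in `S'` is its own blob (attached through `S'`); an endpoint off `S'`
has a neighbour off `S'` (closedness), and `stub_necklaceSpine` (p130753) builds the blob.

Only theorems; no named fact; axioms are the standard three.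
-/

noncomputable section

open Set Metric
open Literature.Probability.LatticeModels
open Literature.Probability.RandomPlanarGeometry
open Summit.CriticalPhenomena.SAWScalingLimit.Theorems.FKGToTraversalBound.Negative (dom)

namespace Summit.CriticalPhenomena.SAWScalingLimit.Theorems.FKGToTraversalBound.SlitNecklace

/-- **One blob.**  For a closed attached defect set `S'` and a non-isolated vertex `a₀` of `D_δ`: a blob
`Ka ∋ a₀` within `infDist (δ a₀) Dᶜ + 3δ` of `δ a₀`, every site of which is joined to the trace of `C` by a
lattice walk through `Ka ∪ S'` and the trace. [folklore] -/
private theorem necklace_blob (D : DobrushinDomain) {δ : ℝ} (hδ : 0 < δ) {c : Site 2}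
    (C : (zdGraph 2).Walk c c) (S' : Finset (Site 2)) (a₀ : Site 2)
    (hid : ∀ x y : Site 2, (discreteDomainGraph (dom C δ) δ).Adj x y ↔
      ((discreteDomainGraph D.carrier δ).Adj x y ∧ x ∉ S' ∧ y ∉ S'))
    (hcl : ∀ y w : Site 2, y ∉ S' → (discreteDomainGraph D.carrier δ).Adj y w →
      ∃ w', (discreteDomainGraph D.carrier δ).Adj y w' ∧ w' ∉ S')
    (hatt : ∀ k ∈ S', ∃ (q : Site 2) (p : (zdGraph 2).Walk k q), q ∈ C.support ∧
      ∀ z ∈ p.support, z ∈ S' ∨ z ∈ C.support)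
    (ha₀ : ∃ w, (discreteDomainGraph D.carrier δ).Adj a₀ w) :
    ∃ Ka : Finset (Site 2), a₀ ∈ Ka ∧
      (∀ k ∈ Ka, dist (meshPoint δ k) (meshPoint δ a₀) ≤ infDist (meshPoint δ a₀) D.carrierᶜ + 3 * δ) ∧
      ∀ k ∈ Ka, ∃ (q : Site 2) (p : (zdGraph 2).Walk k q), q ∈ C.support ∧
        ∀ z ∈ p.support, z ∈ Ka ∨ z ∈ S' ∨ z ∈ C.support := by
  classical
  by_cases haS : a₀ ∈ S'
  · refine ⟨{a₀}, Finset.mem_singleton_self _, fun k hk => ?_, fun k hk => ?_⟩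
    · rw [Finset.mem_singleton] at hk
      rw [hk, dist_self]
      linarith [infDist_nonneg (x := meshPoint δ a₀) (s := D.carrierᶜ)]
    · rw [Finset.mem_singleton] at hk
      subst hk
      obtain ⟨q, p, hq, hp⟩ := hatt k haS
      exact ⟨q, p, hq, fun z hz => Or.inr (hp z hz)⟩
  · obtain ⟨w, hw⟩ := ha₀
    obtain ⟨w₀, hw₀, hw₀S⟩ := hcl a₀ w haS hw
    obtain ⟨Ka, haKa, hrad, hKatt⟩ := stub_necklaceSpine D δ c C S' a₀ w₀ hδ hid hw₀ haS hw₀S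
    refine ⟨Ka, haKa, hrad, fun k hk => ?_⟩
    obtain ⟨q, p, hq, hp⟩ := hKatt k hk
    exact ⟨q, p, hq, fun z hz => (hp z hz).elim Or.inl fun h => Or.inr (Or.inr h)⟩

/-- **Registered part of `stub_necklaceAssemblyFar`: the attached spine of a chord** (see the module
docstring): blobs `Ka ∋ a₀`, `Kb ∋ b₀` within `infDist + 3δ` of the endpoint mesh points, with `Ka ∪ Kb ∪ S'`
attached to the trace of `C`. [folklore] -/
theorem necklace_blobs : ∀ (D : DobrushinDomain) (δ : ℝ) (c : Site 2) (C : (zdGraph 2).Walk c c)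
    (S' : Finset (Site 2)) (a₀ b₀ : Site 2), 0 < δ →
    (∀ x y : Site 2, (discreteDomainGraph (dom C δ) δ).Adj x y ↔
      ((discreteDomainGraph D.carrier δ).Adj x y ∧ x ∉ S' ∧ y ∉ S')) →
    (∀ y w : Site 2, y ∉ S' → (discreteDomainGraph D.carrier δ).Adj y w →
      ∃ w', (discreteDomainGraph D.carrier δ).Adj y w' ∧ w' ∉ S') →
    (∀ k ∈ S', ∃ (q : Site 2) (p : (zdGraph 2).Walk k q), q ∈ C.support ∧
      ∀ z ∈ p.support, z ∈ S' ∨ z ∈ C.support) →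
    (∃ w, (discreteDomainGraph D.carrier δ).Adj a₀ w) → (∃ w, (discreteDomainGraph D.carrier δ).Adj b₀ w) →
    ∃ Ka Kb : Finset (Site 2), a₀ ∈ Ka ∧ b₀ ∈ Kb ∧
      (∀ k ∈ Ka, dist (meshPoint δ k) (meshPoint δ a₀) ≤ infDist (meshPoint δ a₀) D.carrierᶜ + 3 * δ) ∧
      (∀ k ∈ Kb, dist (meshPoint δ k) (meshPoint δ b₀) ≤ infDist (meshPoint δ b₀) D.carrierᶜ + 3 * δ) ∧
      ∀ k ∈ Ka ∪ Kb ∪ S', ∃ (q : Site 2) (p : (zdGraph 2).Walk k q), q ∈ C.support ∧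
        ∀ z ∈ p.support, z ∈ Ka ∪ Kb ∪ S' ∨ z ∈ C.support := by
  intro D δ c C S' a₀ b₀ hδ hid hcl hatt ha₀ hb₀
  obtain ⟨Ka, haKa, hrada, hKa⟩ := necklace_blob D hδ C S' a₀ hid hcl hatt ha₀
  obtain ⟨Kb, hbKb, hradb, hKb⟩ := necklace_blob D hδ C S' b₀ hid hcl hatt hb₀
  refine ⟨Ka, Kb, haKa, hbKb, hrada, hradb, fun k hk => ?_⟩
  simp only [Finset.mem_union] at hk ⊢
  rcases hk with (hk | hk) | hk
  · obtain ⟨q, p, hq, hp⟩ := hKa k hk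
    exact ⟨q, p, hq, fun z hz => (hp z hz).elim (fun h => Or.inl (Or.inl (Or.inl h)))
      fun h => h.elim (fun h => Or.inl (Or.inr h)) Or.inr⟩
  · obtain ⟨q, p, hq, hp⟩ := hKb k hk
    exact ⟨q, p, hq, fun z hz => (hp z hz).elim (fun h => Or.inl (Or.inl (Or.inr h)))
      fun h => h.elim (fun h => Or.inl (Or.inr h)) Or.inr⟩
  · obtain ⟨q, p, hq, hp⟩ := hatt k hk
    exact ⟨q, p, hq, fun z hz => (hp z hz).elim (fun h => Or.inl (Or.inr h)) Or.inr⟩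

end Summit.CriticalPhenomena.SAWScalingLimit.Theorems.FKGToTraversalBound.SlitNecklace

end
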